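import Summits.Ventures.YMGap.RobustBall.RobustStarDoorPV
import Summits.Ventures.YMGap.Thresholds.OneLinkVarianceSDCentred
import HarnessLib

/-!
# Venture YMGap, track ROBUST-BALL (Y2) — `SU(3)` HYPOTHESIS-FREE star cells on the CENTRED Schwinger–Dyson variance (PV2):
# schemas (torus `d = 4`, Y4 `d = 3`, `ℤ⁴`, `ℤ³`; ds-2's variance-form robust star doors) and the `d = 4` / `ℤ⁴` cells

HONEST FRAMING. WHAT THIS IS: a venture file (cell `pub-ymgap`, track Y2 ROBUST-BALL, seat engine-2 (g10); 0 compute).  Explicit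
STRONG-COUPLING constants for lattice `SU(3)` Yang–Mills (small `β`), HYPOTHESIS-FREE (class K outright): ds-2's robust vertex-star doors in
VARIANCE FORM (`RobustStarDoorVariance.torusClusteringOnBallUpTo_of_robustStar_variance`, `clusterDomainClustering_dim3_of_robustStar_variance`,
`RobustStarDoorZdVariance.massGapOnBallZdG_of_robustStar_variance`; generic in a Poincaré constant `c_P` and a variance bound `v`) fed with
Bakry–Émery's `c_P = 1/(3(1/2 − R))` and engine-2 g10's CENTRED Schwinger–Dyson variance `OneLinkVarianceSDCentred.oneLinkVarianceBound_sdc`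
in the enveloped form `v = 3(1/2 − R)·K_s²`, `16τ(τ−1) + 9τ³R² ≤ 16(τ−1)K_s²(1/2−R)` (so that `√(c_P v) = K_s ≥ K_PV2(3,R;τ)`), radius
`R = 2(d−1)β_W/9`: robust coefficient `c ≥ e^{ε₀} K_s β_W/9`, off-column rows `λ ≥ e^{ε₀/2} S_q ε₁` with `3S_q²(1/2−R) ≥ 1`, then ds-2's three
door inequalities verbatim (`θ = (2d−2)c + λ < 1`, `doorPoly d c < 1`, `ρ < 1` at Neumann depth `Kn`).
* §1 `su3_pv2_star_inputs` + SCHEMAS `su3_torusClusteringOnBallUpTo_pv2Star` (`d = 4` torus, tree coupling `β_W/3`),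
  `su3_clusterDomainClustering_dim3_pv2Star` (Y4's `ClusterDomainClustering` on `ClusterDomainFR ε₀ ε₁ r` + torus, `d = 3`),
  `su3_massGapOnBallZdG_pv2Star` (`ℤ⁴`, 't Hooft `β_W/9`), `su3_massGapOnBallZdG_dim3_pv2Star` (`ℤ³`);
* §2 the `d = 4` torus and `ℤ⁴` CELLS `(β_W, ε)` on the one-parameter ball `(ε₀, ε₁) = (2ε, ε)` (exact rationals; `e^{2ε}`, `e^{ε}` by
  `Real.exp_bound'` with five terms; certificates `HOME/pub-ymgap-engine-2/pv2/cert_rows.{py,json}`):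
  (1/8, .269) (1/6, .223) (1/5, .185) (1/4, .127) (27/100, .103) (3/10, .065) (31/100, .052) (1/3, .020) (17/50, .011).
  BEFORE (hypothesis-free `SU(3)`, same currencies): ds-2's PV-variance cells `…_starPV_…` (`RowsSU3StarPV`, b06479e46691) (1/8, .263) (1/6, .212)
  (1/5, .170) (1/4, .102) (3/10, .029), frontier `β_W ≈ 0.318`; engine-2 g9's Kantorovich-form `…_pvStar_…` (1/8, .150) … (31/100, .005).
  Frontier now `β_W = 17/50` (door threshold at `ε → 0` ≈ `0.348`).  The `d = 3` / `ℤ³` cells are the sibling `StarRowsSU3PV2Dim3.lean`.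
WHAT THIS IS NOT: no claim at any `β_W ≥ 0.35` hypothesis-free in this currency; the CERTIFIED cells (GIVEN H1 ∧ H2, `K = 7/5`) of
`TorusRowsSU3StarCertifiedDim4` / `MassGapOnBallZdGRowsSU3Certified` reach `β_W = 11/20` and are untouched; radii are door artefacts; nothing
about the continuum or the Millennium problem.

References: Bakry–Émery (1985); Shen–Zhu–Zhu CMP 400 (2023) Lemma 4.1; the tree: `Thresholds/OneLinkVarianceSDCentred.lean` (engine-2 g10),
`RobustBall/RobustStarDoorVariance.lean`, `RobustStarDoorZdVariance.lean`, `RobustStarDoorPV.lean`, `RowsSU3StarPV.lean` (ds-2 g9).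
-/

noncomputable section

open Finset
open Literature.MathematicalPhysics.QuantumLattice (fundamentalRep)
open Literature.MathematicalPhysics.QuantumFieldTheory hiding ZdEdge
open Literature.MathematicalPhysics.QuantumFieldTheory.Balaban1983to89.StrongCouplingTorusWindow
open Summit.QuantumFields.BalabanUV.InfraRed.StrongCouplingPoincareDoorSUN (OneLinkPoincareSUN)
open Summit.QuantumFields.BalabanUV.InfraRed.StrongCouplingVarianceDoorSUN (OneLinkVarianceBound)
open Summit.Ventures.YMGap.OneLinkVarianceSD (su3_oneLinkPoincare_bakryEmery su3_sqrt_c_le)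
open Summit.Ventures.YMGap.OneLinkVarianceSDC (su3_oneLinkVarianceBound_sdc_of_le)
open Summit.Ventures.YMGap.StarResolventDim (Delta gaugeR doorPoly Delta_pos_of_door gaugeR_lt_one_of_door)

namespace Summit.Ventures.YMGap.RobustBall

/-! ### 1. The PV2 inputs and the `SU(3)` schemas (variance form) -/

/-- **The PV2 door inputs for `SU(3)`**: on the radius `R < 1/2`, with `τ > 1` and rational majorants `K_s ≥ 0`,
`16τ(τ−1) + 9τ³R² ≤ 16(τ−1)K_s²(1/2−R)`, `S_q ≥ 0`, `3S_q²(1/2−R) ≥ 1`, `e^{ε₀} ≤ E`, `e^{ε₀/2} ≤ E₂`: Bakry–Émery's Poincaré constant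
`c_P = 1/(3(1/2−R))`, the centred Schwinger–Dyson variance bound `v = 3(1/2−R)K_s²`, and the two enveloped door inputs
`e^{ε₀}√(c_P v)·x ≤ E K_s x`, `e^{ε₀/2}√c_P·ε₁ ≤ E₂ S_q ε₁`. [folklore] -/
theorem su3_pv2_star_inputs {R ε₀ ε₁ E E₂ τ Ks Sq x : ℝ} (hR : R < 1 / 2) (hτ : 1 < τ) (hε₁ : 0 ≤ ε₁) (hx : 0 ≤ x)
    (hE : Real.exp ε₀ ≤ E) (hE₂ : Real.exp (ε₀ / 2) ≤ E₂) (hKs0 : 0 ≤ Ks)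
    (hKs : 16 * τ * (τ - 1) + 9 * τ ^ 3 * R ^ 2 ≤ 16 * (τ - 1) * (Ks ^ 2 * (1 / 2 - R))) (hSq0 : 0 ≤ Sq)
    (hSq : 1 ≤ 3 * Sq ^ 2 * (1 / 2 - R)) :
    OneLinkPoincareSUN 3 R (1 / (3 * (1 / 2 - R))) ∧ OneLinkVarianceBound 3 R (3 * (1 / 2 - R) * Ks ^ 2) ∧
      Real.exp ε₀ * Real.sqrt (1 / (3 * (1 / 2 - R)) * (3 * (1 / 2 - R) * Ks ^ 2)) * x ≤ E * Ks * x ∧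
      Real.exp (ε₀ / 2) * Real.sqrt (1 / (3 * (1 / 2 - R))) * ε₁ ≤ E₂ * Sq * ε₁ := by
  have hgap : 0 < 1 / 2 - R := by linarith
  have h1 : 0 < τ - 1 := by linarith
  have hE0 : 0 ≤ E := (Real.exp_pos _).le.trans hE
  have hE20 : 0 ≤ E₂ := (Real.exp_pos _).le.trans hE₂
  have hV : OneLinkVarianceBound 3 R (3 * (1 / 2 - R) * Ks ^ 2) :=
    su3_oneLinkVarianceBound_sdc_of_le hτ (by nlinarith [hKs])
  have hcv : 1 / (3 * (1 / 2 - R)) * (3 * (1 / 2 - R) * Ks ^ 2) = Ks ^ 2 := by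
    rw [one_div, ← mul_assoc, inv_mul_cancel₀ (mul_pos (by norm_num : (0 : ℝ) < 3) hgap).ne', one_mul]
  have hKs' : Real.sqrt (1 / (3 * (1 / 2 - R)) * (3 * (1 / 2 - R) * Ks ^ 2)) = Ks := by rw [hcv, Real.sqrt_sq hKs0]
  refine ⟨su3_oneLinkPoincare_bakryEmery hR, hV, ?_, ?_⟩
  · rw [hKs']
    exact mul_le_mul_of_nonneg_right (mul_le_mul_of_nonneg_right hE hKs0) hx
  · exact mul_le_mul_of_nonneg_right (mul_le_mul hE₂ (su3_sqrt_c_le hR hSq0 hSq) (Real.sqrt_nonneg _) hE20) hε₁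

/-- **SCHEMA, `SU(3)`, `d = 4` torus, tier 1, HYPOTHESIS-FREE (PV2 variance form)** (Wilson `β_W`, tree `β_W/3`, radius `R = 6β_W/9 < 1/2`):
the rational certificate gives `TorusClusteringOnBallUpTo 3 4 (β_W/3) ε₀ ε₁ r A m` for some `A` and `m > 0`. [folklore] -/
theorem su3_torusClusteringOnBallUpTo_pv2Star (Kn : ℕ) {βW ε₀ ε₁ c lam E E₂ τ Ks Sq : ℝ} (hβ0 : 0 < βW)
    (hR : βW / 9 * 6 < 1 / 2) (hε₁ : 0 ≤ ε₁) (hE : Real.exp ε₀ ≤ E) (hE₂ : Real.exp (ε₀ / 2) ≤ E₂) (hτ : 1 < τ) (hKs0 : 0 ≤ Ks)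
    (hKs : 16 * τ * (τ - 1) + 9 * τ ^ 3 * (βW / 9 * 6) ^ 2 ≤ 16 * (τ - 1) * (Ks ^ 2 * (1 / 2 - βW / 9 * 6)))
    (hSq0 : 0 ≤ Sq) (hSq : 1 ≤ 3 * Sq ^ 2 * (1 / 2 - βW / 9 * 6)) (hc : E * Ks * (βW / 9) ≤ c)
    (hlam : E₂ * Sq * ε₁ ≤ lam) (hθ1 : 6 * c + lam < 1) (hcd : doorPoly 4 c < 1)
    (hρ1 : gaugeR 4 c + (lam + (6 * c + lam) ^ Kn * (16 * lam)) / (1 - (6 * c + lam)) < 1) (r : ℕ) :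
    ∃ A m : ℝ, 0 < m ∧ TorusClusteringOnBallUpTo 3 4 (βW / 3) ε₀ ε₁ r A m := by
  set R : ℝ := βW / 9 * 6 with hRdef
  have hgap : 0 < 1 / 2 - R := by linarith
  obtain ⟨hP, hV, h1, h2⟩ := su3_pv2_star_inputs (x := βW / 9) hR hτ hε₁ (by positivity) hE hE₂ hKs0 hKs hSq0 hSq
  have hc0 : 0 ≤ c := le_trans (le_trans (by positivity) h1) hc
  have hE20 : 0 ≤ E₂ := (Real.exp_pos _).le.trans hE₂
  have hlam0 : 0 ≤ lam := le_trans (by positivity) hlam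
  set θ : ℝ := 6 * c + lam with hθ
  set ρ : ℝ := gaugeR 4 c + (lam + θ ^ Kn * (16 * lam)) / (1 - θ) with hρ
  have hθ0 : 0 ≤ θ := by positivity
  have hgR := gaugeR_lt_one_of_door (d := 4) (by norm_num) hc0 hcd
  have hρ0 : 0 ≤ ρ := by
    have : 0 ≤ θ ^ Kn := pow_nonneg hθ0 Kn
    have h1' : 0 < 1 - θ := by linarith
    rw [hρ]; exact add_nonneg hgR.1 (div_nonneg (by positivity) h1'.le)
  have e33 : βW / 3 / ((3 : ℕ) : ℝ) = βW / 9 := by norm_num; ring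
  have hb' : βW / 3 / ((3 : ℕ) : ℝ) * (2 * (((4 : ℕ) : ℝ) - 1)) ≤ R := by rw [e33, hRdef]; norm_num
  have hc' : Real.exp ε₀ * Real.sqrt (1 / (3 * (1 / 2 - R)) * (3 * (1 / 2 - R) * Ks ^ 2)) * (βW / 3 / ((3 : ℕ) : ℝ)) ≤ c := by
    rw [e33]; exact h1.trans hc
  have hθ' : θ = (2 * ((4 : ℕ) : ℝ) - 2) * c + lam := by rw [hθ]; push_cast; ring
  have hρ' : ρ = gaugeR 4 c + (lam + θ ^ Kn * (4 * ((4 : ℕ) : ℝ) * lam)) / (1 - θ) := by rw [hρ]; push_cast; ring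
  have h := torusClusteringOnBallUpTo_of_robustStar_variance (d := 4) (N := 3) (by norm_num) (by norm_num) r Kn (by positivity)
    (by positivity) hb' hP hV hε₁ hc' (h2.trans hlam) hθ' hθ1 hcd hρ' hρ1
  refine ⟨_, _, ?_, h⟩
  have h1' : 0 < 1 - ρ := by linarith
  have hden : 0 < 2 * (2 * ρ * ((2 * 4 : ℕ) : ℝ) + 1) := by push_cast; nlinarith
  positivity

/-- **SCHEMA, `SU(3)`, `d = 3`, HYPOTHESIS-FREE (PV2 variance form)**: Y4's `ClusterDomainClustering` on `ClusterDomainFR ε₀ ε₁ r` up to tree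
coupling `β_W/3` (radius `R = 4β_W/9`; door `doorPoly 3 c < 1`, `θ = 4c + λ`), plus the torus form. [folklore] -/
theorem su3_clusterDomainClustering_dim3_pv2Star (Kn : ℕ) {βW ε₀ ε₁ c lam E E₂ τ Ks Sq : ℝ} (hβ0 : 0 < βW)
    (hR : βW / 9 * 4 < 1 / 2) (hε₁ : 0 ≤ ε₁) (hE : Real.exp ε₀ ≤ E) (hE₂ : Real.exp (ε₀ / 2) ≤ E₂) (hτ : 1 < τ) (hKs0 : 0 ≤ Ks)
    (hKs : 16 * τ * (τ - 1) + 9 * τ ^ 3 * (βW / 9 * 4) ^ 2 ≤ 16 * (τ - 1) * (Ks ^ 2 * (1 / 2 - βW / 9 * 4)))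
    (hSq0 : 0 ≤ Sq) (hSq : 1 ≤ 3 * Sq ^ 2 * (1 / 2 - βW / 9 * 4)) (hc : E * Ks * (βW / 9) ≤ c)
    (hlam : E₂ * Sq * ε₁ ≤ lam) (hθ1 : 4 * c + lam < 1) (hcd : doorPoly 3 c < 1)
    (hρ1 : gaugeR 3 c + (lam + (4 * c + lam) ^ Kn * (12 * lam)) / (1 - (4 * c + lam)) < 1) (r : ℕ) :
    ∃ m : ℝ, 0 < m ∧
      YM3IR.ClusterDomainClustering (G := SUN 3)
        ⟨fundamentalRep (Fin 3), βW / 3, fun _ _ W => W ∈ ClusterDomainFR ε₀ ε₁ r⟩ suFrobDist m ∧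
      ∃ A : ℝ, TorusClusteringOnBallUpTo 3 3 (βW / 3) ε₀ ε₁ r A m := by
  set R : ℝ := βW / 9 * 4 with hRdef
  have hgap : 0 < 1 / 2 - R := by linarith
  obtain ⟨hP, hV, h1, h2⟩ := su3_pv2_star_inputs (x := βW / 9) hR hτ hε₁ (by positivity) hE hE₂ hKs0 hKs hSq0 hSq
  have hc0 : 0 ≤ c := le_trans (le_trans (by positivity) h1) hc
  have hE20 : 0 ≤ E₂ := (Real.exp_pos _).le.trans hE₂
  have hlam0 : 0 ≤ lam := le_trans (by positivity) hlam
  set θ : ℝ := 4 * c + lam with hθ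
  set ρ : ℝ := gaugeR 3 c + (lam + θ ^ Kn * (12 * lam)) / (1 - θ) with hρ
  have hθ0 : 0 ≤ θ := by positivity
  have hgR := gaugeR_lt_one_of_door (d := 3) (by norm_num) hc0 hcd
  have hρ0 : 0 ≤ ρ := by
    have : 0 ≤ θ ^ Kn := pow_nonneg hθ0 Kn
    have h1' : 0 < 1 - θ := by linarith
    rw [hρ]; exact add_nonneg hgR.1 (div_nonneg (by positivity) h1'.le)
  have e33 : βW / 3 / ((3 : ℕ) : ℝ) = βW / 9 := by norm_num; ring
  have hb4 : βW / 3 / ((3 : ℕ) : ℝ) * 4 ≤ R := by rw [e33, hRdef]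
  have hb' : βW / 3 / ((3 : ℕ) : ℝ) * (2 * (((3 : ℕ) : ℝ) - 1)) ≤ R := by rw [e33, hRdef]; norm_num
  have hc' : Real.exp ε₀ * Real.sqrt (1 / (3 * (1 / 2 - R)) * (3 * (1 / 2 - R) * Ks ^ 2)) * (βW / 3 / ((3 : ℕ) : ℝ)) ≤ c := by
    rw [e33]; exact h1.trans hc
  have hθ' : θ = (2 * ((3 : ℕ) : ℝ) - 2) * c + lam := by rw [hθ]; push_cast; ring
  have hρ' : ρ = gaugeR 3 c + (lam + θ ^ Kn * (4 * ((3 : ℕ) : ℝ) * lam)) / (1 - θ) := by rw [hρ]; push_cast; ring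
  have hm : 0 < (1 - ρ) ^ 2 / (2 * (2 * ρ * ((2 * 3 : ℕ) : ℝ) + 1)) / ((max r 1 + 2 : ℕ) : ℝ) := by
    have h1' : 0 < 1 - ρ := by linarith
    have hden : 0 < 2 * (2 * ρ * ((2 * 3 : ℕ) : ℝ) + 1) := by push_cast; nlinarith
    positivity
  refine ⟨_, hm, clusterDomainClustering_dim3_of_robustStar_variance (N := 3) (by norm_num) r Kn (by positivity) (by positivity) hb4 hP hV
    hε₁ hc' (h2.trans hlam) hθ hθ1 hcd hρ hρ1, _,
    torusClusteringOnBallUpTo_of_robustStar_variance (d := 3) (N := 3) (by norm_num) (by norm_num) r Kn (by positivity) (by positivity) hb'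
      hP hV hε₁ hc' (h2.trans hlam) hθ' hθ1 hcd hρ' hρ1⟩

/-- **SCHEMA, `SU(3)`, `ℤ⁴`, HYPOTHESIS-FREE (PV2 variance form)** ('t Hooft coupling `β_W/9`, radius `6β_W/9`): `MassGapOnBallZdG 4 3 (β_W/9) ε₀ ε₁ R`
— ds-2's robust vertex-star door on `ℤ⁴` (`RobustStarDoorZdVariance`). [folklore] -/
theorem su3_massGapOnBallZdG_pv2Star (Kn : ℕ) {βW ε₀ ε₁ c lam E E₂ τ Ks Sq : ℝ} (hβ0 : 0 < βW)
    (hR : βW / 9 * 6 < 1 / 2) (hε₁ : 0 ≤ ε₁) (hE : Real.exp ε₀ ≤ E) (hE₂ : Real.exp (ε₀ / 2) ≤ E₂) (hτ : 1 < τ) (hKs0 : 0 ≤ Ks)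
    (hKs : 16 * τ * (τ - 1) + 9 * τ ^ 3 * (βW / 9 * 6) ^ 2 ≤ 16 * (τ - 1) * (Ks ^ 2 * (1 / 2 - βW / 9 * 6)))
    (hSq0 : 0 ≤ Sq) (hSq : 1 ≤ 3 * Sq ^ 2 * (1 / 2 - βW / 9 * 6)) (hc : E * Ks * (βW / 9) ≤ c)
    (hlam : E₂ * Sq * ε₁ ≤ lam) (hθ1 : 6 * c + lam < 1) (hcd : doorPoly 4 c < 1)
    (hρ1 : gaugeR 4 c + (lam + (6 * c + lam) ^ Kn * (16 * lam)) / (1 - (6 * c + lam)) < 1) (Rr : ℕ) :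
    MassGapOnBallZdG 4 3 (βW / 9) ε₀ ε₁ Rr := by
  set R : ℝ := βW / 9 * 6 with hRdef
  have hgap : 0 < 1 / 2 - R := by linarith
  obtain ⟨hP, hV, h1, h2⟩ := su3_pv2_star_inputs (x := βW / 9) hR hτ hε₁ (by positivity) hE hE₂ hKs0 hKs hSq0 hSq
  have htN : |((3 : ℕ) : ℝ) * (βW / 9)| / ((3 : ℕ) : ℝ) = βW / 9 := by
    rw [abs_of_nonneg (by positivity)]; field_simp
  have hb' : |((3 : ℕ) : ℝ) * (βW / 9)| / ((3 : ℕ) : ℝ) * (2 * (((4 : ℕ) : ℝ) - 1)) ≤ R := by rw [htN, hRdef]; norm_num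
  have hc' : Real.exp ε₀ * Real.sqrt (1 / (3 * (1 / 2 - R)) * (3 * (1 / 2 - R) * Ks ^ 2)) *
      (|((3 : ℕ) : ℝ) * (βW / 9)| / ((3 : ℕ) : ℝ)) ≤ c := by
    rw [htN]; exact h1.trans hc
  have hθ' : (6 : ℝ) * c + lam = (2 * ((4 : ℕ) : ℝ) - 2) * c + lam := by push_cast; ring
  have hρ' : gaugeR 4 c + (lam + (6 * c + lam) ^ Kn * (16 * lam)) / (1 - (6 * c + lam)) =
      gaugeR 4 c + (lam + (6 * c + lam) ^ Kn * (4 * ((4 : ℕ) : ℝ) * lam)) / (1 - (6 * c + lam)) := by push_cast; ring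
  exact massGapOnBallZdG_of_robustStar_variance (d := 4) (N := 3) (by norm_num) (by norm_num) (Kn := Kn) (by positivity) (by positivity)
    hb' hP hV hε₁ hc' (h2.trans hlam) hθ' hθ1 hcd hρ' hρ1

/-- **SCHEMA, `SU(3)`, `ℤ³`, HYPOTHESIS-FREE (PV2 variance form)** ('t Hooft coupling `β_W/9`, radius `4β_W/9`): `MassGapOnBallZdG 3 3 (β_W/9) ε₀ ε₁ R`.
[folklore] -/
theorem su3_massGapOnBallZdG_dim3_pv2Star (Kn : ℕ) {βW ε₀ ε₁ c lam E E₂ τ Ks Sq : ℝ} (hβ0 : 0 < βW)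
    (hR : βW / 9 * 4 < 1 / 2) (hε₁ : 0 ≤ ε₁) (hE : Real.exp ε₀ ≤ E) (hE₂ : Real.exp (ε₀ / 2) ≤ E₂) (hτ : 1 < τ) (hKs0 : 0 ≤ Ks)
    (hKs : 16 * τ * (τ - 1) + 9 * τ ^ 3 * (βW / 9 * 4) ^ 2 ≤ 16 * (τ - 1) * (Ks ^ 2 * (1 / 2 - βW / 9 * 4)))
    (hSq0 : 0 ≤ Sq) (hSq : 1 ≤ 3 * Sq ^ 2 * (1 / 2 - βW / 9 * 4)) (hc : E * Ks * (βW / 9) ≤ c)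
    (hlam : E₂ * Sq * ε₁ ≤ lam) (hθ1 : 4 * c + lam < 1) (hcd : doorPoly 3 c < 1)
    (hρ1 : gaugeR 3 c + (lam + (4 * c + lam) ^ Kn * (12 * lam)) / (1 - (4 * c + lam)) < 1) (Rr : ℕ) :
    MassGapOnBallZdG 3 3 (βW / 9) ε₀ ε₁ Rr := by
  set R : ℝ := βW / 9 * 4 with hRdef
  have hgap : 0 < 1 / 2 - R := by linarith
  obtain ⟨hP, hV, h1, h2⟩ := su3_pv2_star_inputs (x := βW / 9) hR hτ hε₁ (by positivity) hE hE₂ hKs0 hKs hSq0 hSq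
  have htN : |((3 : ℕ) : ℝ) * (βW / 9)| / ((3 : ℕ) : ℝ) = βW / 9 := by
    rw [abs_of_nonneg (by positivity)]; field_simp
  have hb' : |((3 : ℕ) : ℝ) * (βW / 9)| / ((3 : ℕ) : ℝ) * (2 * (((3 : ℕ) : ℝ) - 1)) ≤ R := by rw [htN, hRdef]; norm_num
  have hc' : Real.exp ε₀ * Real.sqrt (1 / (3 * (1 / 2 - R)) * (3 * (1 / 2 - R) * Ks ^ 2)) *
      (|((3 : ℕ) : ℝ) * (βW / 9)| / ((3 : ℕ) : ℝ)) ≤ c := by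
    rw [htN]; exact h1.trans hc
  have hθ' : (4 : ℝ) * c + lam = (2 * ((3 : ℕ) : ℝ) - 2) * c + lam := by push_cast; ring
  have hρ' : gaugeR 3 c + (lam + (4 * c + lam) ^ Kn * (12 * lam)) / (1 - (4 * c + lam)) =
      gaugeR 3 c + (lam + (4 * c + lam) ^ Kn * (4 * ((3 : ℕ) : ℝ) * lam)) / (1 - (4 * c + lam)) := by push_cast; ring
  exact massGapOnBallZdG_of_robustStar_variance (d := 3) (N := 3) (by norm_num) (by norm_num) (Kn := Kn) (by positivity) (by positivity)
    hb' hP hV hε₁ hc' (h2.trans hlam) hθ' hθ1 hcd hρ' hρ1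

/-- **SCHEMA, `SU(3)`, `ℤ⁴`, HYPOTHESIS-FREE (PV2 variance form), FREE MODULUS RADIUS** (`0 ≤ β_W`, `6β_W/9 ≤ R_m < 1/2`; the envelope and `S_q` at
`R_m`): `MassGapOnBallZdG 4 3 (β_W/9) ε₀ ε₁ R` — the shape the segment rows consume (one certificate at `R_m` serves every smaller coupling). [folklore] -/
theorem su3_massGapOnBallZdG_pv2Star_rad (Kn : ℕ) {βW ε₀ ε₁ c lam E E₂ τ Ks Sq Rm : ℝ} (hβ0 : 0 ≤ βW) (hRm : βW / 9 * 6 ≤ Rm)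
    (hR : Rm < 1 / 2) (hε₁ : 0 ≤ ε₁) (hE : Real.exp ε₀ ≤ E) (hE₂ : Real.exp (ε₀ / 2) ≤ E₂) (hτ : 1 < τ) (hKs0 : 0 ≤ Ks)
    (hKs : 16 * τ * (τ - 1) + 9 * τ ^ 3 * Rm ^ 2 ≤ 16 * (τ - 1) * (Ks ^ 2 * (1 / 2 - Rm)))
    (hSq0 : 0 ≤ Sq) (hSq : 1 ≤ 3 * Sq ^ 2 * (1 / 2 - Rm)) (hc : E * Ks * (βW / 9) ≤ c)
    (hlam : E₂ * Sq * ε₁ ≤ lam) (hθ1 : 6 * c + lam < 1) (hcd : doorPoly 4 c < 1)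
    (hρ1 : gaugeR 4 c + (lam + (6 * c + lam) ^ Kn * (16 * lam)) / (1 - (6 * c + lam)) < 1) (Rr : ℕ) :
    MassGapOnBallZdG 4 3 (βW / 9) ε₀ ε₁ Rr := by
  obtain ⟨hP, hV, h1, h2⟩ := su3_pv2_star_inputs (x := βW / 9) hR hτ hε₁ (by positivity) hE hE₂ hKs0 hKs hSq0 hSq
  have htN : |((3 : ℕ) : ℝ) * (βW / 9)| / ((3 : ℕ) : ℝ) = βW / 9 := by
    rw [abs_of_nonneg (by positivity)]; field_simp
  have hb' : |((3 : ℕ) : ℝ) * (βW / 9)| / ((3 : ℕ) : ℝ) * (2 * (((4 : ℕ) : ℝ) - 1)) ≤ Rm := by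
    rw [htN]; norm_num; linarith
  have hc' : Real.exp ε₀ * Real.sqrt (1 / (3 * (1 / 2 - Rm)) * (3 * (1 / 2 - Rm) * Ks ^ 2)) *
      (|((3 : ℕ) : ℝ) * (βW / 9)| / ((3 : ℕ) : ℝ)) ≤ c := by
    rw [htN]; exact h1.trans hc
  have hθ' : (6 : ℝ) * c + lam = (2 * ((4 : ℕ) : ℝ) - 2) * c + lam := by push_cast; ring
  have hρ' : gaugeR 4 c + (lam + (6 * c + lam) ^ Kn * (16 * lam)) / (1 - (6 * c + lam)) =
      gaugeR 4 c + (lam + (6 * c + lam) ^ Kn * (4 * ((4 : ℕ) : ℝ) * lam)) / (1 - (6 * c + lam)) := by push_cast; ring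
  exact massGapOnBallZdG_of_robustStar_variance (d := 4) (N := 3) (by norm_num) (by norm_num) (Kn := Kn) (by positivity) (by positivity)
    hb' hP hV hε₁ hc' (h2.trans hlam) hθ' hθ1 hcd hρ' hρ1

/-- **SCHEMA, `SU(3)`, `ℤ³`, HYPOTHESIS-FREE (PV2 variance form), FREE MODULUS RADIUS** (`0 ≤ β_W`, `4β_W/9 ≤ R_m < 1/2`):
`MassGapOnBallZdG 3 3 (β_W/9) ε₀ ε₁ R`. [folklore] -/
theorem su3_massGapOnBallZdG_dim3_pv2Star_rad (Kn : ℕ) {βW ε₀ ε₁ c lam E E₂ τ Ks Sq Rm : ℝ} (hβ0 : 0 ≤ βW) (hRm : βW / 9 * 4 ≤ Rm)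
    (hR : Rm < 1 / 2) (hε₁ : 0 ≤ ε₁) (hE : Real.exp ε₀ ≤ E) (hE₂ : Real.exp (ε₀ / 2) ≤ E₂) (hτ : 1 < τ) (hKs0 : 0 ≤ Ks)
    (hKs : 16 * τ * (τ - 1) + 9 * τ ^ 3 * Rm ^ 2 ≤ 16 * (τ - 1) * (Ks ^ 2 * (1 / 2 - Rm)))
    (hSq0 : 0 ≤ Sq) (hSq : 1 ≤ 3 * Sq ^ 2 * (1 / 2 - Rm)) (hc : E * Ks * (βW / 9) ≤ c)
    (hlam : E₂ * Sq * ε₁ ≤ lam) (hθ1 : 4 * c + lam < 1) (hcd : doorPoly 3 c < 1)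
    (hρ1 : gaugeR 3 c + (lam + (4 * c + lam) ^ Kn * (12 * lam)) / (1 - (4 * c + lam)) < 1) (Rr : ℕ) :
    MassGapOnBallZdG 3 3 (βW / 9) ε₀ ε₁ Rr := by
  obtain ⟨hP, hV, h1, h2⟩ := su3_pv2_star_inputs (x := βW / 9) hR hτ hε₁ (by positivity) hE hE₂ hKs0 hKs hSq0 hSq
  have htN : |((3 : ℕ) : ℝ) * (βW / 9)| / ((3 : ℕ) : ℝ) = βW / 9 := by
    rw [abs_of_nonneg (by positivity)]; field_simp
  have hb' : |((3 : ℕ) : ℝ) * (βW / 9)| / ((3 : ℕ) : ℝ) * (2 * (((3 : ℕ) : ℝ) - 1)) ≤ Rm := by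
    rw [htN]; norm_num; linarith
  have hc' : Real.exp ε₀ * Real.sqrt (1 / (3 * (1 / 2 - Rm)) * (3 * (1 / 2 - Rm) * Ks ^ 2)) *
      (|((3 : ℕ) : ℝ) * (βW / 9)| / ((3 : ℕ) : ℝ)) ≤ c := by
    rw [htN]; exact h1.trans hc
  have hθ' : (4 : ℝ) * c + lam = (2 * ((3 : ℕ) : ℝ) - 2) * c + lam := by push_cast; ring
  have hρ' : gaugeR 3 c + (lam + (4 * c + lam) ^ Kn * (12 * lam)) / (1 - (4 * c + lam)) =
      gaugeR 3 c + (lam + (4 * c + lam) ^ Kn * (4 * ((3 : ℕ) : ℝ) * lam)) / (1 - (4 * c + lam)) := by push_cast; ring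
  exact massGapOnBallZdG_of_robustStar_variance (d := 3) (N := 3) (by norm_num) (by norm_num) (Kn := Kn) (by positivity) (by positivity)
    hb' hP hV hε₁ hc' (h2.trans hlam) hθ' hθ1 hcd hρ' hρ1

/-! ### 2. The `d = 4` torus cells -/

/-- `SU(3)`, `d = 4`, HYPOTHESIS-FREE: row `(1/8, .269)` — torus clustering on the whole tier-1 ball `(2ε, ε)`, `ε = 269 / 1000`, for every
tree coupling up to `β_W/3 = 1 / 24` (PV2 at radius `1 / 12`, `τ = 531 / 500`, `K_s = 6609 / 4000`; certificate `c = 39301 / 1000000`, `λ = 62973 / 200000`, `E = 1712617 / 1000000`, `E₂ = 1308657 / 1000000`, `S_q = 223607 / 250000`). [folklore] -/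
theorem su3_torusClusteringOnBallUpTo_pv2Star_oneEighth (r : ℕ) :
    ∃ A m : ℝ, 0 < m ∧ TorusClusteringOnBallUpTo 3 4 (1 / 24) (269 / 500) (269 / 1000) r A m := by
  have e1 : (1 / 8 : ℝ) / 3 = 1 / 24 := by norm_num
  have h := su3_torusClusteringOnBallUpTo_pv2Star 20 (βW := 1 / 8) (ε₀ := 269 / 500) (ε₁ := 269 / 1000) (c := 39301 / 1000000) (lam := 62973 / 200000) (E := 1712617 / 1000000) (E₂ := 1308657 / 1000000) (τ := 531 / 500) (Ks := 6609 / 4000) (Sq := 223607 / 250000)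
    (by norm_num) (by norm_num) (by norm_num) (by refine (Real.exp_bound' (x := 269 / 500) (by norm_num) (by norm_num) (n := 5) (by norm_num)).trans ?_; simp only [Finset.sum_range_succ, Finset.sum_range_zero, Nat.factorial]; norm_num)
    (by refine (Real.exp_bound' (x := 269 / 500 / 2) (by norm_num) (by norm_num) (n := 5) (by norm_num)).trans ?_; simp only [Finset.sum_range_succ, Finset.sum_range_zero, Nat.factorial]; norm_num)
    (by norm_num) (by norm_num) (by norm_num) (by norm_num) (by norm_num) (by norm_num) (by norm_num) (by norm_num) (by unfold doorPoly; norm_num) (by unfold gaugeR Delta; norm_num) r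
  rw [e1] at h
  exact h

/-- `SU(3)`, `d = 4`, HYPOTHESIS-FREE: row `(1/6, .223)` — torus clustering on the whole tier-1 ball `(2ε, ε)`, `ε = 223 / 1000`, for every
tree coupling up to `β_W/3 = 1 / 18` (PV2 at radius `1 / 9`, `τ = 541 / 500`, `K_s = 43719 / 25000`; certificate `c = 50587 / 1000000`, `λ = 64509 / 250000`, `E = 156207 / 100000`, `E₂ = 624911 / 500000`, `S_q = 925821 / 1000000`). [folklore] -/
theorem su3_torusClusteringOnBallUpTo_pv2Star_oneSixth (r : ℕ) :
    ∃ A m : ℝ, 0 < m ∧ TorusClusteringOnBallUpTo 3 4 (1 / 18) (223 / 500) (223 / 1000) r A m := by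
  have e1 : (1 / 6 : ℝ) / 3 = 1 / 18 := by norm_num
  have h := su3_torusClusteringOnBallUpTo_pv2Star 20 (βW := 1 / 6) (ε₀ := 223 / 500) (ε₁ := 223 / 1000) (c := 50587 / 1000000) (lam := 64509 / 250000) (E := 156207 / 100000) (E₂ := 624911 / 500000) (τ := 541 / 500) (Ks := 43719 / 25000) (Sq := 925821 / 1000000)
    (by norm_num) (by norm_num) (by norm_num) (by refine (Real.exp_bound' (x := 223 / 500) (by norm_num) (by norm_num) (n := 5) (by norm_num)).trans ?_; simp only [Finset.sum_range_succ, Finset.sum_range_zero, Nat.factorial]; norm_num)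
    (by refine (Real.exp_bound' (x := 223 / 500 / 2) (by norm_num) (by norm_num) (n := 5) (by norm_num)).trans ?_; simp only [Finset.sum_range_succ, Finset.sum_range_zero, Nat.factorial]; norm_num)
    (by norm_num) (by norm_num) (by norm_num) (by norm_num) (by norm_num) (by norm_num) (by norm_num) (by norm_num) (by unfold doorPoly; norm_num) (by unfold gaugeR Delta; norm_num) r
  rw [e1] at h
  exact h

/-- `SU(3)`, `d = 4`, HYPOTHESIS-FREE: row `(1/5, .185)` — torus clustering on the whole tier-1 ball `(2ε, ε)`, `ε = 37 / 200`, for every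
tree coupling up to `β_W/3 = 1 / 15` (PV2 at radius `2 / 15`, `τ = 549 / 500`, `K_s = 22923 / 12500`; certificate `c = 58999 / 1000000`, `λ = 212237 / 1000000`, `E = 1447743 / 1000000`, `E₂ = 1203219 / 1000000`, `S_q = 953463 / 1000000`). [folklore] -/
theorem su3_torusClusteringOnBallUpTo_pv2Star_oneFifth (r : ℕ) :
    ∃ A m : ℝ, 0 < m ∧ TorusClusteringOnBallUpTo 3 4 (1 / 15) (37 / 100) (37 / 200) r A m := by
  have e1 : (1 / 5 : ℝ) / 3 = 1 / 15 := by norm_num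
  have h := su3_torusClusteringOnBallUpTo_pv2Star 20 (βW := 1 / 5) (ε₀ := 37 / 100) (ε₁ := 37 / 200) (c := 58999 / 1000000) (lam := 212237 / 1000000) (E := 1447743 / 1000000) (E₂ := 1203219 / 1000000) (τ := 549 / 500) (Ks := 22923 / 12500) (Sq := 953463 / 1000000)
    (by norm_num) (by norm_num) (by norm_num) (by refine (Real.exp_bound' (x := 37 / 100) (by norm_num) (by norm_num) (n := 5) (by norm_num)).trans ?_; simp only [Finset.sum_range_succ, Finset.sum_range_zero, Nat.factorial]; norm_num)
    (by refine (Real.exp_bound' (x := 37 / 100 / 2) (by norm_num) (by norm_num) (n := 5) (by norm_num)).trans ?_; simp only [Finset.sum_range_succ, Finset.sum_range_zero, Nat.factorial]; norm_num)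
    (by norm_num) (by norm_num) (by norm_num) (by norm_num) (by norm_num) (by norm_num) (by norm_num) (by norm_num) (by unfold doorPoly; norm_num) (by unfold gaugeR Delta; norm_num) r
  rw [e1] at h
  exact h

/-- `SU(3)`, `d = 4`, HYPOTHESIS-FREE: row `(1/4, .127)` — torus clustering on the whole tier-1 ball `(2ε, ε)`, `ε = 127 / 1000`, for every
tree coupling up to `β_W/3 = 1 / 12` (PV2 at radius `1 / 6`, `τ = 561 / 500`, `K_s = 39541 / 20000`; certificate `c = 70799 / 1000000`, `λ = 144199 / 1000000`, `E = 644587 / 500000`, `E₂ = 567709 / 500000`, `S_q = 1`). [folklore] -/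
theorem su3_torusClusteringOnBallUpTo_pv2Star_oneQuarter (r : ℕ) :
    ∃ A m : ℝ, 0 < m ∧ TorusClusteringOnBallUpTo 3 4 (1 / 12) (127 / 500) (127 / 1000) r A m := by
  have e1 : (1 / 4 : ℝ) / 3 = 1 / 12 := by norm_num
  have h := su3_torusClusteringOnBallUpTo_pv2Star 20 (βW := 1 / 4) (ε₀ := 127 / 500) (ε₁ := 127 / 1000) (c := 70799 / 1000000) (lam := 144199 / 1000000) (E := 644587 / 500000) (E₂ := 567709 / 500000) (τ := 561 / 500) (Ks := 39541 / 20000) (Sq := 1)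
    (by norm_num) (by norm_num) (by norm_num) (by refine (Real.exp_bound' (x := 127 / 500) (by norm_num) (by norm_num) (n := 5) (by norm_num)).trans ?_; simp only [Finset.sum_range_succ, Finset.sum_range_zero, Nat.factorial]; norm_num)
    (by refine (Real.exp_bound' (x := 127 / 500 / 2) (by norm_num) (by norm_num) (n := 5) (by norm_num)).trans ?_; simp only [Finset.sum_range_succ, Finset.sum_range_zero, Nat.factorial]; norm_num)
    (by norm_num) (by norm_num) (by norm_num) (by norm_num) (by norm_num) (by norm_num) (by norm_num) (by norm_num) (by unfold doorPoly; norm_num) (by unfold gaugeR Delta; norm_num) r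
  rw [e1] at h
  exact h

/-- `SU(3)`, `d = 4`, HYPOTHESIS-FREE: row `(27/100, .103)` — torus clustering on the whole tier-1 ball `(2ε, ε)`, `ε = 103 / 1000`, for every
tree coupling up to `β_W/3 = 9 / 100` (PV2 at radius `9 / 50`, `τ = 113 / 100`, `K_s = 51011 / 25000`; certificate `c = 4701 / 62500`, `λ = 11653 / 100000`, `E = 614377 / 500000`, `E₂ = 277123 / 250000`, `S_q = 1020621 / 1000000`). [folklore] -/
theorem su3_torusClusteringOnBallUpTo_pv2Star_twentySevenHundredths (r : ℕ) :
    ∃ A m : ℝ, 0 < m ∧ TorusClusteringOnBallUpTo 3 4 (9 / 100) (103 / 500) (103 / 1000) r A m := by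
  have e1 : (27 / 100 : ℝ) / 3 = 9 / 100 := by norm_num
  have h := su3_torusClusteringOnBallUpTo_pv2Star 20 (βW := 27 / 100) (ε₀ := 103 / 500) (ε₁ := 103 / 1000) (c := 4701 / 62500) (lam := 11653 / 100000) (E := 614377 / 500000) (E₂ := 277123 / 250000) (τ := 113 / 100) (Ks := 51011 / 25000) (Sq := 1020621 / 1000000)
    (by norm_num) (by norm_num) (by norm_num) (by refine (Real.exp_bound' (x := 103 / 500) (by norm_num) (by norm_num) (n := 5) (by norm_num)).trans ?_; simp only [Finset.sum_range_succ, Finset.sum_range_zero, Nat.factorial]; norm_num)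
    (by refine (Real.exp_bound' (x := 103 / 500 / 2) (by norm_num) (by norm_num) (n := 5) (by norm_num)).trans ?_; simp only [Finset.sum_range_succ, Finset.sum_range_zero, Nat.factorial]; norm_num)
    (by norm_num) (by norm_num) (by norm_num) (by norm_num) (by norm_num) (by norm_num) (by norm_num) (by norm_num) (by unfold doorPoly; norm_num) (by unfold gaugeR Delta; norm_num) r
  rw [e1] at h
  exact h

/-- `SU(3)`, `d = 4`, HYPOTHESIS-FREE: row `(3/10, .065)` — torus clustering on the whole tier-1 ball `(2ε, ε)`, `ε = 13 / 200`, for every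
tree coupling up to `β_W/3 = 1 / 10` (PV2 at radius `1 / 5`, `τ = 143 / 125`, `K_s = 53579 / 25000`; certificate `c = 81357 / 1000000`, `λ = 36559 / 500000`, `E = 1138829 / 1000000`, `E₂ = 26679 / 25000`, `S_q = 1054093 / 1000000`). [folklore] -/
theorem su3_torusClusteringOnBallUpTo_pv2Star_threeTenths (r : ℕ) :
    ∃ A m : ℝ, 0 < m ∧ TorusClusteringOnBallUpTo 3 4 (1 / 10) (13 / 100) (13 / 200) r A m := by
  have e1 : (3 / 10 : ℝ) / 3 = 1 / 10 := by norm_num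
  have h := su3_torusClusteringOnBallUpTo_pv2Star 20 (βW := 3 / 10) (ε₀ := 13 / 100) (ε₁ := 13 / 200) (c := 81357 / 1000000) (lam := 36559 / 500000) (E := 1138829 / 1000000) (E₂ := 26679 / 25000) (τ := 143 / 125) (Ks := 53579 / 25000) (Sq := 1054093 / 1000000)
    (by norm_num) (by norm_num) (by norm_num) (by refine (Real.exp_bound' (x := 13 / 100) (by norm_num) (by norm_num) (n := 5) (by norm_num)).trans ?_; simp only [Finset.sum_range_succ, Finset.sum_range_zero, Nat.factorial]; norm_num)
    (by refine (Real.exp_bound' (x := 13 / 100 / 2) (by norm_num) (by norm_num) (n := 5) (by norm_num)).trans ?_; simp only [Finset.sum_range_succ, Finset.sum_range_zero, Nat.factorial]; norm_num)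
    (by norm_num) (by norm_num) (by norm_num) (by norm_num) (by norm_num) (by norm_num) (by norm_num) (by norm_num) (by unfold doorPoly; norm_num) (by unfold gaugeR Delta; norm_num) r
  rw [e1] at h
  exact h

/-- `SU(3)`, `d = 4`, HYPOTHESIS-FREE: row `(31/100, .052)` — torus clustering on the whole tier-1 ball `(2ε, ε)`, `ε = 13 / 250`, for every
tree coupling up to `β_W/3 = 31 / 300` (PV2 at radius `31 / 150`, `τ = 287 / 250`, `K_s = 108983 / 50000`; certificate `c = 41653 / 500000`, `λ = 58391 / 1000000`, `E = 1109601 / 1000000`, `E₂ = 16459 / 15625`, `S_q = 266501 / 250000`). [folklore] -/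
theorem su3_torusClusteringOnBallUpTo_pv2Star_thirtyOneHundredths (r : ℕ) :
    ∃ A m : ℝ, 0 < m ∧ TorusClusteringOnBallUpTo 3 4 (31 / 300) (13 / 125) (13 / 250) r A m := by
  have e1 : (31 / 100 : ℝ) / 3 = 31 / 300 := by norm_num
  have h := su3_torusClusteringOnBallUpTo_pv2Star 20 (βW := 31 / 100) (ε₀ := 13 / 125) (ε₁ := 13 / 250) (c := 41653 / 500000) (lam := 58391 / 1000000) (E := 1109601 / 1000000) (E₂ := 16459 / 15625) (τ := 287 / 250) (Ks := 108983 / 50000) (Sq := 266501 / 250000)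
    (by norm_num) (by norm_num) (by norm_num) (by refine (Real.exp_bound' (x := 13 / 125) (by norm_num) (by norm_num) (n := 5) (by norm_num)).trans ?_; simp only [Finset.sum_range_succ, Finset.sum_range_zero, Nat.factorial]; norm_num)
    (by refine (Real.exp_bound' (x := 13 / 125 / 2) (by norm_num) (by norm_num) (n := 5) (by norm_num)).trans ?_; simp only [Finset.sum_range_succ, Finset.sum_range_zero, Nat.factorial]; norm_num)
    (by norm_num) (by norm_num) (by norm_num) (by norm_num) (by norm_num) (by norm_num) (by norm_num) (by norm_num) (by unfold doorPoly; norm_num) (by unfold gaugeR Delta; norm_num) r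
  rw [e1] at h
  exact h

/-- `SU(3)`, `d = 4`, HYPOTHESIS-FREE: row `(1/3, .020)` — torus clustering on the whole tier-1 ball `(2ε, ε)`, `ε = 1 / 50`, for every
tree coupling up to `β_W/3 = 1 / 9` (PV2 at radius `2 / 9`, `τ = 29 / 25`, `K_s = 226971 / 100000`; certificate `c = 17499 / 200000`, `λ = 1397 / 62500`, `E = 1040811 / 1000000`, `E₂ = 510101 / 500000`, `S_q = 547723 / 500000`). [folklore] -/
theorem su3_torusClusteringOnBallUpTo_pv2Star_oneThird (r : ℕ) :
    ∃ A m : ℝ, 0 < m ∧ TorusClusteringOnBallUpTo 3 4 (1 / 9) (1 / 25) (1 / 50) r A m := by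
  have e1 : (1 / 3 : ℝ) / 3 = 1 / 9 := by norm_num
  have h := su3_torusClusteringOnBallUpTo_pv2Star 20 (βW := 1 / 3) (ε₀ := 1 / 25) (ε₁ := 1 / 50) (c := 17499 / 200000) (lam := 1397 / 62500) (E := 1040811 / 1000000) (E₂ := 510101 / 500000) (τ := 29 / 25) (Ks := 226971 / 100000) (Sq := 547723 / 500000)
    (by norm_num) (by norm_num) (by norm_num) (by refine (Real.exp_bound' (x := 1 / 25) (by norm_num) (by norm_num) (n := 5) (by norm_num)).trans ?_; simp only [Finset.sum_range_succ, Finset.sum_range_zero, Nat.factorial]; norm_num)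
    (by refine (Real.exp_bound' (x := 1 / 25 / 2) (by norm_num) (by norm_num) (n := 5) (by norm_num)).trans ?_; simp only [Finset.sum_range_succ, Finset.sum_range_zero, Nat.factorial]; norm_num)
    (by norm_num) (by norm_num) (by norm_num) (by norm_num) (by norm_num) (by norm_num) (by norm_num) (by norm_num) (by unfold doorPoly; norm_num) (by unfold gaugeR Delta; norm_num) r
  rw [e1] at h
  exact h

/-- `SU(3)`, `d = 4`, HYPOTHESIS-FREE: row `(17/50, .011)` — torus clustering on the whole tier-1 ball `(2ε, ε)`, `ε = 11 / 1000`, for every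
tree coupling up to `β_W/3 = 17 / 150` (PV2 at radius `17 / 75`, `τ = 581 / 500`, `K_s = 229679 / 100000`; certificate `c = 44349 / 500000`, `λ = 6141 / 500000`, `E = 255561 / 250000`, `E₂ = 1011061 / 1000000`, `S_q = 276079 / 250000`). [folklore] -/
theorem su3_torusClusteringOnBallUpTo_pv2Star_seventeenFiftieths (r : ℕ) :
    ∃ A m : ℝ, 0 < m ∧ TorusClusteringOnBallUpTo 3 4 (17 / 150) (11 / 500) (11 / 1000) r A m := by
  have e1 : (17 / 50 : ℝ) / 3 = 17 / 150 := by norm_num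
  have h := su3_torusClusteringOnBallUpTo_pv2Star 20 (βW := 17 / 50) (ε₀ := 11 / 500) (ε₁ := 11 / 1000) (c := 44349 / 500000) (lam := 6141 / 500000) (E := 255561 / 250000) (E₂ := 1011061 / 1000000) (τ := 581 / 500) (Ks := 229679 / 100000) (Sq := 276079 / 250000)
    (by norm_num) (by norm_num) (by norm_num) (by refine (Real.exp_bound' (x := 11 / 500) (by norm_num) (by norm_num) (n := 5) (by norm_num)).trans ?_; simp only [Finset.sum_range_succ, Finset.sum_range_zero, Nat.factorial]; norm_num)
    (by refine (Real.exp_bound' (x := 11 / 500 / 2) (by norm_num) (by norm_num) (n := 5) (by norm_num)).trans ?_; simp only [Finset.sum_range_succ, Finset.sum_range_zero, Nat.factorial]; norm_num)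
    (by norm_num) (by norm_num) (by norm_num) (by norm_num) (by norm_num) (by norm_num) (by norm_num) (by norm_num) (by unfold doorPoly; norm_num) (by unfold gaugeR Delta; norm_num) r
  rw [e1] at h
  exact h

end Summit.Ventures.YMGap.RobustBall

end
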